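import Summits.Langlands.Langlands.Theses.DyadicOddResidue
import Summits.Langlands.Langlands.Theorems.DyadicOddResidueDyadicNonsolvableFM
import Summits.Langlands.Langlands.Theorems.DyadicOddResidueDyadicEisensteinFMSketchEngines
import Literature.NumberTheory.Automorphic.FontaineMazurGL2PotCrystallineOrdinary
import Literature.NumberTheory.Automorphic.POrdinaryHeckeAlgebraGL2
import HarnessLib

/-!
# Line `thorne-dense-weight-two` for the crux `DyadicOddResidue.DyadicEisensteinFM`
# (stmt-Langlands-18741) — CHECKED SKELETON (crux-plan, round 1, v2)

Idea card `Cruxes/DyadicEisensteinFM/Ideas/thorne-dense-weight-two.md` (ideator 2), triage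
`TRIAGE-r1-1.md` / `TRIAGE-r1-2.md` (both: pass, with sharpenings), line card
`Lines/thorne-dense-weight-two.md`.

## The line in one paragraph

Split the crux by the shape of `ρ` at `2`: ORDINARY up to a Tate twist (`OrdinaryUpToTwist`:
some `ρ ⊗ ε₂^a` is Skinner–Wiles ordinary of a weight `k ≥ 2` at the place above `2`) or not.
The ordinary half is attacked by the card's lever, typed WITHOUT positing a deformation functor:
a **2-adic ordinary determinant family** (`OrdDetFamily`: a profinite local Noetherian ring `R`
with a continuous Chenevier determinant `D : Γ_ℚ → R` of dimension `2`, unramified outside a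
finite set, with local characters `D|_{Γ_{ℚ₂}} = ψ₁ ⊕ ψ₂`, `ψ₂` of finite order on inertia)
through `ρ ⊗ ε₂^a`, in which the WELL-ORIENTED THORNE POINTS (irreducible, odd, a.e. unramified,
potentially crystalline Skinner–Wiles-ordinary of weight `2` up to a Tate twist — verbatim the
hypotheses of the named fact `Thorne2026_fontaineMazurGL2_potCrystallineOrdinary` — IN A FRAME
WHOSE QUOTIENT CHARACTER IS THE FAMILY'S `ψ₂`) together with the reducible points are ZARISKI
DENSE (`stub_ordinaryFamilyDenseCapture` = the card's `C⁺_ord`: `R^{ps,ord,odd}_S` minus its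
dual-oriented components is module-finite over `Λ = ℤ₂⟦T⟧` with every component dominant, the
weight-`(2,χ)` primes `χ ≠ 1` are dense in `Λ`, and over them every point of a well-oriented
component is well-oriented-Thorne or reducible; transported by the LANDED engine
`nilpotent_of_forall_mem_primes_over`, p145036 — see the proved reduction
`OrdDetFamily.dense_of_transport`).  Thorne's Theorem D (`stub_thorne2026`, NAMED FACT) makes
those points newform points (`isNewformPoint_of_isWellOrientedThornePoint`, proved; density
transferred by `dense_mono`, proved), and Hida's control theorem at `p = 2` in family-intrinsic
form (`stub_familyClassicality`: in an ordinary determinant family with dense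
well-oriented-newform-or-reducible points, every point carrying `ρₓ ⊗ ε₂^a` Skinner–Wiles
ordinary of weight `k ≥ 2` with `ρₓ` irreducible is a newform point up to a Tate twist; Hida,
*Elementary Modular Iwasawa Theory*, Thm. 4.2.47 with `𝐩 = 4`; Ghate–Kumar 2013) makes `ρ`
modular up to a Tate twist.  WHY ORIENTATION: determinants cannot tell the sub from the quotient,
so every ordinary determinant family `D` has the dual twin `D ⊗ det⁻¹` (old unit-root character,
inverted, as the generic SUB); on the twin the weight-`2` points are not Thorne-shaped and the
arithmetic-weight-`k` points are locally-split companion points whose classicality is NOT Hida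
control — the orientation clause excludes the twin (no point of it is well oriented) and puts that
burden where it belongs, in the deformation-theoretic stub.  The non-ordinary half
(`stub_nonOrdinaryHalf`: `2`-adic Pan for `ρ` irreducible at `2` — the route's foreseen child
`IrreducibleAtTwo`, NOT this card's mechanism, shared with the Koch lines) is registered so that
the composition concludes the crux BY NAME.  The landed dictionary
`exists_cuspidal_satakeFrobCompatible_of_tateTwistNewform` (any prime) converts "newform up to a
Tate twist" into the crux's automorphic conclusion.

Composition: `tateTwistNewform_of_hypotheses : S₁ → S₂ → S₃ → S₄ → (crux ρ ⟹ TateTwistNewform ρ)`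
(pure logic + the proved lemmas, stub propositions as named hypotheses), then
`DyadicEisensteinFM_of : DyadicEisensteinFM` — the crux BY NAME from the four `stub_*` and the
landed dictionary.

## Disproof used

`Cruxes/DyadicEisensteinFM/Disproof.lean` (cdisprove cycle 1, NO KILL, no `_false_without_`
theorem, `-- Targets: none`).  Honoured: §3 load-bearing analysis — `hirr` is used at
`stub_familyClassicality` (irreducible points only; reducible points are Eisenstein) and by the
dictionary's caller; `hodd` is used at `stub_ordinaryFamilyDenseCapture` (the family is the ODD
quotient `D(c) = -1`, which is what makes its weight-`2` points Thorne-shaped) and is a clause of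
every Thorne point; a.e.-unramified feeds the finite ramification set; de Rham regularity is what
puts `ρ` in one of the two halves with `k ≥ 2`.  §0 ("oddness residually invisible", `ρ̄(c)`
unipotent) is exactly why no stub splits anything by `ρ(c)`: no GMA idempotent, no Taylor–Wiles
prime, no residual multiplicity-freeness is used anywhere in the line.  Landed Negative lemmas
(`OddnessResiduallyInvisible`, `ConclusionForcesUnramified`, `ResidualCharactersAtTwo`,
`EisensteinResidueTraceCriterion`) refute no stub instance (structural facts about the residue).

NOTHING in this file is asserted except the four `stub_*` theorems (the only `sorry`s): the stub
STATEMENTS are the named propositions `OrdinaryFamilyDenseCapture`, the Literature fact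
`Thorne2026_fontaineMazurGL2_potCrystallineOrdinary`, `FamilyClassicality`, `NonOrdinaryHalf`
(so that the composition's hypotheses are the stubs BY NAME); every other `def`/`structure` is
vocabulary consumed by those types, and `dense_mono`, `dense_of_transport`,
`isOrdinaryOfWeightAt_of_isOriented`, `isNewformPoint_of_isWellOrientedThornePoint`,
`tateTwistNewform_of_hypotheses`, `DyadicEisensteinFM_of` are proved.
-/

set_option linter.dupNamespace false
set_option linter.unusedVariables false
set_option autoImplicit false

noncomputable section

open scoped MatrixGroups NumberField ModularForm
open NumberField IsDedekindDomain Field Filter CongruenceSubgroup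
open Literature.NumberTheory.GaloisRepresentations
open Literature.NumberTheory.Automorphic
open Literature.NumberTheory.EllipticCurves.ModularForms
open Summit.Langlands.Langlands.Theses.DyadicOddResidue

namespace Summit.Langlands.Langlands.Cruxes.DyadicEisensteinFM.ThorneDenseWeightTwo

/-! ## 0. Vocabulary (nothing asserted) -/

/-- **Newform modularity up to a Tate twist** at `ℓ = 2` — VERBATIM the conclusion shape of the
named facts `Thorne2026_fontaineMazurGL2_potCrystallineOrdinary`,
`Pan2022_proModularDeRhamClassical_GL2Q`, `XZhang2024_fontaineMazurGL2_tateTwist` and the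
hypothesis of the landed dictionary `exists_cuspidal_satakeFrobCompatible_of_tateTwistNewform`:
some `ρ ⊗ ε₂^m` is attached away from `2N` to a newform `f ∈ S_k(Γ₁(N))`. [folklore] -/
def TateTwistNewform (ρ : FramedGaloisRep ℚ (PadicAlgCl 2) 2) : Prop :=
  ∃ (χ : absoluteGaloisGroup ℚ →ₜ* (PadicAlgCl 2)ˣ) (m : ℤ),
    (∀ σ, χ σ = cyclotomicPadicAlgCl ℚ 2 σ ^ m) ∧
    ∃ (N : ℕ) (_ : NeZero N) (k : ℤ) (f : CuspForm (Gamma1 N) k)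
      (ιf : coeffCharField f →+* PadicAlgCl 2),
      IsNewform1 f ∧ IsGaloisRepOfNewform1 f ιf {q | q ∣ N * 2} (FramedRep.twist ρ χ)

/-- **Ordinary datum** for the case split: the Tate twist `ρ ⊗ χ₀`, `χ₀ = ε₂^a`, is Skinner–Wiles
ordinary of weight `k ≥ 2` with inertial exponent `m > 0` at every place above `2`
(`IsOrdinaryOfWeightAt`: `≅ (ψ₁ε^{k-1} ∗; 0 ψ₂)` with `ψᵢ|_I` of order dividing `m`). [folklore] -/
def IsOrdinaryDatum (ρ : FramedGaloisRep ℚ (PadicAlgCl 2) 2)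
    (χ₀ : absoluteGaloisGroup ℚ →ₜ* (PadicAlgCl 2)ˣ) (a : ℤ) (k m : ℕ) : Prop :=
  (∀ σ, χ₀ σ = cyclotomicPadicAlgCl ℚ 2 σ ^ a) ∧ 2 ≤ k ∧ 0 < m ∧
    ∀ v : HeightOneSpectrum (𝓞 ℚ), ((2 : ℕ) : 𝓞 ℚ) ∈ v.asIdeal →
      FramedGaloisRep.IsOrdinaryOfWeightAt 2 (FramedRep.twist ρ χ₀) v k m

/-- **The case split**: `ρ` is ordinary at `2` of some weight `k ≥ 2` up to a Tate twist.  (A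
reducible-at-`2` de Rham `ρ` with distinct Hodge–Tate weights is of this shape for one of its two
flags — Bloch–Kato `H¹_g`; the complement is the irreducible-at-`2` half in nature.) [folklore] -/
def OrdinaryUpToTwist (ρ : FramedGaloisRep ℚ (PadicAlgCl 2) 2) : Prop :=
  ∃ (χ₀ : absoluteGaloisGroup ℚ →ₜ* (PadicAlgCl 2)ˣ) (a : ℤ) (k m : ℕ), IsOrdinaryDatum ρ χ₀ a k m

/-- **Oriented ordinarity of weight `2`**: `IsOrdinaryOfWeightAt 2 ρ' v 2 m` with the QUOTIENT
character of the upper-triangular frame PINNED to a given function `θ₂ : Γ_{ℚ_v} → ℚ̄₂` (the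
lower-right entries of `Q⁻¹ ρ' Q`).  Used to orient a family point against the family's own
finite-order local character. [folklore] -/
def IsOrientedOrdinaryWeightTwoAt (ρ' : FramedGaloisRep ℚ (PadicAlgCl 2) 2)
    (v : HeightOneSpectrum (𝓞 ℚ)) (m : ℕ)
    (θ₂ : absoluteGaloisGroup (v.adicCompletion ℚ) → PadicAlgCl 2) : Prop :=
  ∃ Q : GL (Fin 2) (PadicAlgCl 2), ∀ σ : absoluteGaloisGroup (v.adicCompletion ℚ),
    (Q⁻¹ * ρ'.toLocal v σ * Q).val 1 0 = 0 ∧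
    (Q⁻¹ * ρ'.toLocal v σ * Q).val 1 1 = θ₂ σ ∧
    (σ ∈ absInertia (v.adicCompletion ℚ) →
      (Q⁻¹ * ρ'.toLocal v σ * Q).val 1 1 ^ m = 1 ∧
      (Q⁻¹ * ρ'.toLocal v σ * Q).val 0 0 ^ m =
        algebraMap ℤ_[2] (PadicAlgCl 2)
          ((GaloisRep.cyclotomicCharacter (v.adicCompletion ℚ) 2 σ : ℤ_[2]ˣ) : ℤ_[2]) ^
            ((2 - 1) * m))

/-- Forgetting the orientation: an oriented-ordinary representation is Skinner–Wiles ordinary of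
weight `2` (same frame). [folklore] -/
theorem isOrdinaryOfWeightAt_of_isOriented {ρ' : FramedGaloisRep ℚ (PadicAlgCl 2) 2}
    {v : HeightOneSpectrum (𝓞 ℚ)} {m : ℕ}
    {θ₂ : absoluteGaloisGroup (v.adicCompletion ℚ) → PadicAlgCl 2}
    (h : IsOrientedOrdinaryWeightTwoAt ρ' v m θ₂) :
    FramedGaloisRep.IsOrdinaryOfWeightAt 2 ρ' v 2 m := by
  obtain ⟨Q, hQ⟩ := h
  exact ⟨Q, fun σ => ⟨(hQ σ).1, (hQ σ).2.2⟩⟩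

/-- **A `2`-adic ordinary determinant family** (the typed stand-in for the well-oriented part of
`Spec R^{ps,ord,odd}_S(χ̄₁ + χ̄₂)`; POSITED VOCABULARY, no instance claimed here — existence through
a given `ρ` is `stub_ordinaryFamilyDenseCapture`): a compact Hausdorff (profinite) local Noetherian
topological ring `R` carrying a continuous Chenevier determinant `D = (T, det) : Γ_ℚ → R` of
dimension `2` (`PseudoRep2`, valid in characteristic `2`), unramified outside a finite set of
places, with CHOSEN continuous local characters `ψ₁, ψ₂ : Γ_{ℚ_v} → Rˣ` at every `v ∣ 2`
splitting `D|_{Γ_{ℚ_v}} = ψ₁ ⊕ ψ₂` and `ψ₂` of finite order `∣ ordExponent` on inertia (the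
universal "framed-by-characters" ordinary triple `(D, ψ₁, ψ₂)`; a determinant alone would not know
the sub from the quotient — the orientation of POINTS against `ψ₂` is `IsWellOrientedThornePoint`).
No oddness, no universality and no `Λ`-structure are fields: they are the business of whoever
instantiates. [cite: Chenevier2014, §1.2 and §3.1] -/
structure OrdDetFamily : Type 1 where
  /-- the coefficient ring -/
  R : Type
  [commRing : CommRing R]
  [topologicalSpace : TopologicalSpace R]
  [isTopologicalRing : IsTopologicalRing R]
  [compactSpace : CompactSpace R]
  [t2Space : T2Space R]
  [isLocalRing : IsLocalRing R]
  [isNoetherianRing : IsNoetherianRing R]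
  /-- the determinant of dimension `2` -/
  D : PseudoRep2 (absoluteGaloisGroup ℚ) R
  /-- continuity of trace and determinant for the Krull topology -/
  isContinuous : D.IsContinuous
  /-- finite ramification -/
  finite_ramification : ∃ S : Set (HeightOneSpectrum (𝓞 ℚ)), S.Finite ∧
    ∀ v, v ∉ S → D.IsUnramifiedAt v
  /-- first local character at the places above `2` -/
  ordChar₁ : (v : HeightOneSpectrum (𝓞 ℚ)) → ((2 : ℕ) : 𝓞 ℚ) ∈ v.asIdeal →
    (absoluteGaloisGroup (v.adicCompletion ℚ) →ₜ* Rˣ)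
  /-- second local character at the places above `2` (the one of finite order on inertia) -/
  ordChar₂ : (v : HeightOneSpectrum (𝓞 ℚ)) → ((2 : ℕ) : 𝓞 ℚ) ∈ v.asIdeal →
    (absoluteGaloisGroup (v.adicCompletion ℚ) →ₜ* Rˣ)
  /-- the inertial exponent of `ψ₂` -/
  ordExponent : ℕ
  ordExponent_pos : 0 < ordExponent
  /-- ordinary shape: `D|_{Γ_{ℚ_v}} = ψ₁ ⊕ ψ₂` -/
  comp_toLocal : ∀ (v : HeightOneSpectrum (𝓞 ℚ)) (hv : ((2 : ℕ) : 𝓞 ℚ) ∈ v.asIdeal),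
    D.comp (absGaloisRestrict ℚ (v.adicCompletion ℚ)).toMonoidHom =
      PseudoRep2.ofCharacters (ordChar₁ v hv).toMonoidHom (ordChar₂ v hv).toMonoidHom
  /-- `ψ₂` has finite order dividing `ordExponent` on inertia -/
  ordChar₂_pow : ∀ (v : HeightOneSpectrum (𝓞 ℚ)) (hv : ((2 : ℕ) : 𝓞 ℚ) ∈ v.asIdeal) (σ),
    σ ∈ absInertia (v.adicCompletion ℚ) → ordChar₂ v hv σ ^ ordExponent = 1

attribute [instance] OrdDetFamily.commRing OrdDetFamily.topologicalSpace
  OrdDetFamily.isTopologicalRing OrdDetFamily.compactSpace OrdDetFamily.t2Space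
  OrdDetFamily.isLocalRing OrdDetFamily.isNoetherianRing

namespace OrdDetFamily

variable (𝓕 : OrdDetFamily)

/-- A **point** of the family: a CONTINUOUS ring homomorphism `R → ℚ̄₂` (`ℚ̄₂ = PadicAlgCl 2`
with its valuation topology; continuity = integrality/locality of the specialisation, cf. the
`IsLocalPoint` lesson of `SkinnerWilesDefectOne`). [folklore] -/
def IsPoint (x : 𝓕.R →+* PadicAlgCl 2) : Prop := Continuous x

/-- A **reducible point**: the specialised determinant is a sum of two characters (Eisenstein
points, algebraic notion — no continuity asked of `η₁, η₂`). [folklore] -/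
def IsReduciblePoint (x : 𝓕.R →+* PadicAlgCl 2) : Prop :=
  ∃ η₁ η₂ : absoluteGaloisGroup ℚ →* (PadicAlgCl 2)ˣ, 𝓕.D.map x = PseudoRep2.ofCharacters η₁ η₂

/-- A **newform point**: the specialised determinant is `(tr ρₓ, det ρₓ)` of a continuous
`ρₓ : Γ_ℚ → GL₂(ℚ̄₂)` attached to a newform up to a Tate twist (`TateTwistNewform`). [folklore] -/
def IsNewformPoint (x : 𝓕.R →+* PadicAlgCl 2) : Prop :=
  ∃ ρx : FramedGaloisRep ℚ (PadicAlgCl 2) 2,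
    PseudoRep2.ofRep (ρx : absoluteGaloisGroup ℚ →* GL (Fin 2) (PadicAlgCl 2)) = 𝓕.D.map x ∧
    TateTwistNewform ρx

/-- A **well-oriented Thorne point** `x`: the specialised determinant is that of a continuous `ρₓ`
satisfying VERBATIM the hypotheses of `Thorne2026_fontaineMazurGL2_potCrystallineOrdinary` at
`p = 2` (a.e. unramified, irreducible, odd; some `ρₓ ⊗ ε₂^a` potentially crystalline and
Skinner–Wiles ordinary of weight `2`), the ordinary frame being ORIENTED BY THE FAMILY: its
quotient character is `x ∘ ψ₂` (times `ε₂^a`).  In `R^{ps,ord,odd}_S` every irreducible point of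
an arithmetically oriented component over a weight-`(2,χ)` prime, `χ ≠ 1` of `2`-power order, is
one (potential crystallinity is automatic for `χ ≠ 1`: the `χ⁻¹`-eigenpart of `L^× ⊗ ℚ̄₂` lies in
`𝒪_L^× ⊗ ℚ̄₂`); NO point of a dual-oriented component `D ⊗ det⁻¹` is one.
[cite: Thorne2026FontaineMazurGL2, Theorem D] -/
def IsWellOrientedThornePoint (x : 𝓕.R →+* PadicAlgCl 2) : Prop :=
  ∃ ρx : FramedGaloisRep ℚ (PadicAlgCl 2) 2,
    PseudoRep2.ofRep (ρx : absoluteGaloisGroup ℚ →* GL (Fin 2) (PadicAlgCl 2)) = 𝓕.D.map x ∧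
    (∀ᶠ v : HeightOneSpectrum (𝓞 ℚ) in cofinite, ρx.IsUnramifiedAt v) ∧
    ρx.toGaloisRep.IsIrreducible ∧ ρx.IsOdd ∧
    ∃ (χ₀ : absoluteGaloisGroup ℚ →ₜ* (PadicAlgCl 2)ˣ) (a : ℤ) (m : ℕ),
      (∀ σ, χ₀ σ = cyclotomicPadicAlgCl ℚ 2 σ ^ a) ∧ 0 < m ∧
      ∀ (v : HeightOneSpectrum (𝓞 ℚ)) (hv : ((2 : ℕ) : 𝓞 ℚ) ∈ v.asIdeal),
        IsOrientedOrdinaryWeightTwoAt (FramedRep.twist ρx χ₀) v m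
          (fun σ => x (((𝓕.ordChar₂ v hv σ : 𝓕.Rˣ) : 𝓕.R)) *
            (((χ₀ (absGaloisRestrict ℚ (v.adicCompletion ℚ) σ) : (PadicAlgCl 2)ˣ) :
              PadicAlgCl 2))) ∧
        (Literature.NumberTheory.PAdicHodge.fontainePstAdicCompletion v 2 hv).IsDeRhamFramed
          (FramedGaloisRep.toLocal v (FramedRep.twist ρx χ₀)) ∧
        ∀ r, (Literature.NumberTheory.PAdicHodge.fontainePstAdicCompletion v 2 hv).IsWeilDeligneOf
          (FramedGaloisRep.toLocal v (FramedRep.twist ρx χ₀)) r → r.N = 0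

/-- **Zariski density of a class of points** `P` in `Spec R`: an element of `R` killed by every
point of the class is nilpotent. [folklore] -/
def Dense (P : (𝓕.R →+* PadicAlgCl 2) → Prop) : Prop :=
  ∀ f : 𝓕.R, (∀ x : 𝓕.R →+* PadicAlgCl 2, 𝓕.IsPoint x → P x → x f = 0) → IsNilpotent f

/-- Density is monotone in the class of points. [folklore] -/
theorem dense_mono {P Q : (𝓕.R →+* PadicAlgCl 2) → Prop} (hPQ : ∀ x, 𝓕.IsPoint x → P x → Q x)
    (hP : 𝓕.Dense P) : 𝓕.Dense Q :=
  fun f hf => hP f fun x hx hPx => hf x hx (hPQ x hx hPx)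

/-- **The card's engine, wired** (reduction of `stub_ordinaryFamilyDenseCapture` to `C⁺_ord`):
if `R` is an integral algebra over a domain `Λ` (e.g. module-finite over `Λ = ℤ₂⟦T⟧` —
`C⁺_ord (i)`), every minimal prime of `R` contracts to `⊥` (every irreducible component dominates
weight space — `C⁺_ord (ii)`), `W` is a set of primes of `Λ` with `⋂ W = 0` (the weight-`(2,χ)`
primes, `χ ≠ 1` of `2`-power order: infinitely many height-one primes of the two-dimensional
regular local ring `Λ`), and every prime of `R` over `W` contains the kernel of a `P`-point (over a
weight-`(2,χ)` prime every point of a well-oriented component is reducible or well-oriented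
Thorne), then the `P`-points are Zariski dense — by the LANDED transport lemma
`Theorems.DyadicEisensteinFM.nilpotent_of_forall_mem_primes_over` (p145036). [folklore] -/
theorem dense_of_transport {Λ : Type*} [CommRing Λ] [IsDomain Λ] [Algebra Λ 𝓕.R]
    [Algebra.IsIntegral Λ 𝓕.R]
    (hdom : ∀ q ∈ minimalPrimes 𝓕.R, Ideal.comap (algebraMap Λ 𝓕.R) q = ⊥)
    (W : Set (Ideal Λ)) (hWp : ∀ P ∈ W, P.IsPrime) (hW : ∀ c : Λ, (∀ P ∈ W, c ∈ P) → c = 0)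
    {P : (𝓕.R →+* PadicAlgCl 2) → Prop}
    (hpts : ∀ 𝔓 : Ideal 𝓕.R, 𝔓.IsPrime → Ideal.comap (algebraMap Λ 𝓕.R) 𝔓 ∈ W →
      ∃ x : 𝓕.R →+* PadicAlgCl 2, 𝓕.IsPoint x ∧ P x ∧ RingHom.ker x ≤ 𝔓) :
    𝓕.Dense P := by
  intro f hf
  refine Summit.Langlands.Langlands.Theorems.DyadicEisensteinFM.nilpotent_of_forall_mem_primes_over
    hdom W hWp hW f fun 𝔓 h𝔓 hW𝔓 => ?_
  obtain ⟨x, hx, hPx, hker⟩ := hpts 𝔓 h𝔓 hW𝔓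
  exact hker (by rw [RingHom.mem_ker]; exact hf x hx hPx)

end OrdDetFamily

/-! ## 1. The registered stubs (the ONLY `sorry`s of the file) -/

/-- **Stub S1 `stub_ordinaryFamilyDenseCapture` — THE CARD'S BET `C⁺_ord` (HARDEST; size XL;
deformation theory at `p = 2` in the non-distinguished Eisenstein cell).**  For every `ρ` in the
crux (residually reducible, irreducible, odd, a.e. unramified, de Rham regular at `2`) and every
ordinary datum `(χ₀ = ε₂^a, k ≥ 2, m)` for it, there is a `2`-adic ordinary determinant family
`𝓕` and a point `x` of `𝓕` specialising `𝓕.D` to `(tr, det)` of `ρ ⊗ χ₀`, in which the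
WELL-ORIENTED-THORNE-OR-REDUCIBLE points are Zariski dense.  Intended instance and proof (card +
triage + this plan): `𝓕.R := R^{ps,ord,odd}_S(χ̄₁+χ̄₂) / (⋂ of the minimal primes of its
ARITHMETICALLY ORIENTED, generically-split and Eisenstein components)` — item D0: the universal
ring of triples `(D, ψ₁, ψ₂)`, `D` a Chenevier determinant of `Γ_{ℚ,S}` deforming
`ρ̄^ss = χ̄₁ ⊕ χ̄₂` (`S = {2} ∪ ram ρ`), `D|_{Γ_{ℚ₂}} = ψ₁ ⊕ ψ₂`, `ψ₂^m|_{I₂} = 1`, `det D(c) = -1`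
(oddness as a closed condition — Disproof §3: `hodd` load-bearing), representable by
Chenevier 2014 Prop. 3.3/3.7 + closed conditions with NO multiplicity-free / `2`-distinguished
hypothesis (triage r1-1 (b), r1-2); a component is "arithmetically oriented" when its generic
representation has `ψ₂` as QUOTIENT (its dual twin `D ⊗ det⁻¹` has it as sub and is discarded);
`x` classifies `ρ ⊗ χ₀` and lies on an oriented component (non-split at `2`: automatic; split:
the oriented characteristic-`0` deformation ring at `x`, Kisin-style, is positive-dimensional along
the weight — part of (ii)); density by `OrdDetFamily.dense_of_transport` from (i) `R` module-finite
over `Λ = ℤ₂⟦T⟧` (`T ↦ ψ₁∘Art₂(5)·5⁻¹ − 1`), (ii) every minimal prime dominant (no irreducible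
component over a proper closed subset of weight space), (iii) over a weight-`(2,χ)` prime, `χ ≠ 1`,
every point of an oriented component is reducible or well-oriented Thorne (`χ ≠ 1` ⇒ potentially
crystalline; irreducible determinant over `ℚ̄₂` ⇒ `ofRep` of a continuous irreducible `ρ_y`,
Chenevier Thm. 2.12; `Ker D = Ker ρ` for semisimple `ρ` gives a.e. unramified).  WHY IT MIGHT
FAIL: (i) at a one-dimensional prime of characteristic `2` is finiteness of a fixed-weight
Greenberg Selmer group over `𝔽₂⟦u⟧` — no Taylor–Wiles-free proof is known (the card's honest
residue; its failure exhibits a fixed-weight `𝔽₂((u))`-family, the object Pan's method patches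
at); (ii) is the PatchingLocalComponent moral in dimension form (an isolated fixed-weight component
is invisible to weight-`2` points); the reducible locus is `Λ`-finite by Iwasawa theory over `ℚ`
at `p = 2` (Weber: odd class numbers of `ℚ(ζ_{2^n})`), and Wake–Wang-Erickson's
`I^{red}/I^{red 2} ↞ B ⊗ C` presentation must be redone at `p = 2`.  VACUITY NOTE (triage F1/(a)):
for `S ⊆ {2, ℓ, ∞}`, `ℓ ≡ ±3 (8)`, no irreducible crux `ρ` is ordinary up to twist
(`D₂ = G_{ℚ,S}(2)`, landed `unique_prime_above_two`), so this stub has content exactly when `S`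
leaves the free-product range (`15a1`, `14a1`, `17a1`, …).  Sources: Thorne arXiv:2608.07186
Thm D; Chenevier2014 §§1.2, 2.12, 3.1–3.7; WakeWangErickson2018 (Amer. J. Math. 140), 2020
(Duke 169); Hida EMIT Cor. 4.2.44–45 (`Λ`-finiteness, torsion-freeness of `H^{ord}` at `𝐩 = 4`);
Bellaïche arXiv:1505.01216 p.5 (why GMA methods fail at `p = 2`). -/
def OrdinaryFamilyDenseCapture : Prop :=
    ∀ (ρ : FramedGaloisRep ℚ (PadicAlgCl 2) 2), ¬ ρ.IsResiduallyAbsIrreducible →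
      ρ.toGaloisRep.IsIrreducible → ρ.IsOdd →
      (∀ᶠ v : HeightOneSpectrum (𝓞 ℚ) in cofinite, ρ.IsUnramifiedAt v) →
      (∀ (v : HeightOneSpectrum (𝓞 ℚ)) (hv : ((2 : ℕ) : 𝓞 ℚ) ∈ v.asIdeal),
        (Literature.NumberTheory.PAdicHodge.fontainePstAdicCompletion v 2 hv).IsDeRhamFramed
            (ρ.toLocal v) ∧
          ∀ τ : v.adicCompletion ℚ →+* PadicAlgCl 2, Continuous τ →
            (ρ.labelledHodgeTateWeightsAt v
              (Literature.NumberTheory.PAdicHodge.fontainePstAdicCompletion v 2 hv).algebra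
              (Literature.NumberTheory.PAdicHodge.fontainePstAdicCompletion v 2 hv).𝔅 τ).Nodup) →
      ∀ (χ₀ : absoluteGaloisGroup ℚ →ₜ* (PadicAlgCl 2)ˣ) (a : ℤ) (k m : ℕ),
        IsOrdinaryDatum ρ χ₀ a k m →
        ∃ (𝓕 : OrdDetFamily) (x : 𝓕.R →+* PadicAlgCl 2), 𝓕.IsPoint x ∧
          PseudoRep2.ofRep ((FramedRep.twist ρ χ₀ : FramedGaloisRep ℚ (PadicAlgCl 2) 2) :
              absoluteGaloisGroup ℚ →* GL (Fin 2) (PadicAlgCl 2)) = 𝓕.D.map x ∧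
          𝓕.Dense (fun y => 𝓕.IsWellOrientedThornePoint y ∨ 𝓕.IsReduciblePoint y)

/-- **Registered stub S1 (HARDEST, XL; uses `hodd`, `hirr`, `hunr` of the crux): `OrdinaryFamilyDenseCapture`** —
statement, intended instance/proof, why-it-might-fail and sources in the docstring of the `def`. -/
theorem stub_ordinaryFamilyDenseCapture : OrdinaryFamilyDenseCapture := by
  sorry

/-- **Stub S2 `stub_thorne2026` = NAMED FACT (Thorne 2026, Theorem D; Literature fact
`Literature.NumberTheory.Automorphic.Thorne2026_fontaineMazurGL2_potCrystallineOrdinary`,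
accepted).**  Not a proof obligation of the line: discharging it is formalising a depth-`C`
modularity lifting theorem with characteristic-`0` Taylor–Wiles places, Honda–Tate/Serre–Tate
ordinary HBAV approximants, potential modularity and Serre's conjecture (XL).  It is the ONLY
place where automorphy enters the ordinary half, and it enters at the weight-`2` points of the
family, never at `ρ` (ResiduallyReducibleBarrierNarrow clause (c): TW places relative to the
characteristic-`0` representation). [cite: Thorne2026FontaineMazurGL2, Theorem D (p. 3 of arXiv:2608.07186)] -/
theorem stub_thorne2026 : Thorne2026_fontaineMazurGL2_potCrystallineOrdinary := by
  sorry

/-- **Stub S3 `stub_familyClassicality` — HIDA CONTROL AT `p = 2` IN FAMILY-INTRINSIC FORM (size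
L).**  In a `2`-adic ordinary determinant family in which the points that are (well-oriented Thorne
AND newform) or reducible are Zariski dense, every point `x` whose determinant is `(tr, det)` of
`ρₓ ⊗ ε₂^a` with `ρₓ` IRREDUCIBLE (Disproof §3: `hirr` is used here — reducible points are
Eisenstein) and `ρₓ ⊗ ε₂^a` Skinner–Wiles ordinary of weight `k ≥ 2` at `2`, is a newform point:
`TateTwistNewform ρₓ`.  Intended proof: `R' = R/nil ↪ ∏_{dense points} ℚ̄₂`; reducible points lie
on `V(J)`, `J` the ideal of `4 × 4` trace discriminants, and `x ∉ V(J)`, so well-oriented newform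
points are dense on every irreducible component through `x`; a component with dense WELL-ORIENTED
weight-`2` points is arithmetically oriented (its generic representation has `ψ₂` as quotient) or
generically split — never the dual twin —, so its dense newform points are `2`-ORDINARY newforms
IN THE ARITHMETIC NORMALISATION (unit-root quotient `= ψ₂`, Tate shift pinned by the weight-`2`
frame), of ONE tame level `N(S, D̄)` (`R` local with finite residue field and finite ramification
set: Swan conductors at odd `ℓ` are those of `D̄`, Serre–Tate), hence eigensystems of Hida's
`h^{ord}(N; ℤ₂⟦ℤ₂^×⟧)`; the closed subalgebra of `h^{ord} × R'` generated by the Frobenius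
coefficients projects injectively into `h^{ord}` and onto `R'` (compactness + density + continuity
of points), so `x` extends to a point of `h^{ord}` (integrality, `ℚ̄₂` algebraically closed) whose
weight is read off `ψ₁ˣ|_{I₂} = ε^{k-1}·finite`: arithmetic of weight `k ≥ 2`, hence CLASSICAL by
Hida's control theorem at `p = 2` (Hida, Elementary Modular Iwasawa Theory, Thm. 4.2.47 and
Cor. 4.2.44–45 with `𝐩 = 4`; Ghate–Kumar 2013, Zbl 1307.11068); so `tr (ρₓ ⊗ ε^a)` is the
eigensystem of a classical ordinary eigenform of weight `k`, cuspidal because `ρₓ` is irreducible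
(Brauer–Nesbitt + Chebotarev), whose newform (finite nebentype twist absorbed, Atkin–Li) gives
`TateTwistNewform ρₓ`.  WHY IT MIGHT FAIL: control in weight `k = 2` at `p = 2` needs level `4N`
(`𝐩 = 4`); at the Eisenstein `𝔪` only the REDUCED Hecke algebra is reached (enough for
eigensystems); the determinant on `h^{ord}_𝔪`, `p = 2`, Eisenstein `𝔪`, must be glued as a
Chenevier determinant (no Wiles pseudo-representation: `ρ(c)` has nothing to split); the
orientation lemma "generic quotient `ψ₂` ⇒ no well-oriented weight-`2` point on the dual twin"
is this plan's and unprinted (elementary: `ε|_{I₂}` has infinite order).  Sources: Hida EMIT §4.2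
(Thm 4.2.47, Cor 4.2.44–45); GhateKumar2013; Hida86b; Chenevier2014 §1.2–1.4;
DeligneSerreASENS1974 Thm 6.1; AtkinLi1978 §3. -/
def FamilyClassicality : Prop :=
    ∀ (𝓕 : OrdDetFamily),
      𝓕.Dense (fun y => (𝓕.IsWellOrientedThornePoint y ∧ 𝓕.IsNewformPoint y) ∨
        𝓕.IsReduciblePoint y) →
      ∀ (x : 𝓕.R →+* PadicAlgCl 2), 𝓕.IsPoint x →
      ∀ (ρx : FramedGaloisRep ℚ (PadicAlgCl 2) 2)
        (χ₀ : absoluteGaloisGroup ℚ →ₜ* (PadicAlgCl 2)ˣ) (a : ℤ) (k m : ℕ),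
        PseudoRep2.ofRep ((FramedRep.twist ρx χ₀ : FramedGaloisRep ℚ (PadicAlgCl 2) 2) :
            absoluteGaloisGroup ℚ →* GL (Fin 2) (PadicAlgCl 2)) = 𝓕.D.map x →
        ρx.toGaloisRep.IsIrreducible → IsOrdinaryDatum ρx χ₀ a k m →
        TateTwistNewform ρx

/-- **Registered stub S3 (L; Hida control at `p = 2`, `𝐩 = 4`; uses `hirr`): `FamilyClassicality`** —
statement, intended proof, why-it-might-fail and sources in the docstring of the `def`. -/
theorem stub_familyClassicality : FamilyClassicality := by
  sorry

/-- **Stub S4 `stub_nonOrdinaryHalf` — REGIME STUB, honestly labelled: the NON-ORDINARY half of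
the crux (`2`-adic Pan for `ρ` irreducible at `2`; the route's foreseen child `IrreducibleAtTwo`;
size: open problem).**  NOT this line's mechanism — it is the target of the Koch lines
(`koch-pro2-fern` ≈ `koch-free-product-assembly`: big `R^{ps} = 𝕋` on completed cohomology by the
`2`-adic fern / mod-`2` `R̄ = A` + Nakayama, occurrence in `H̃¹` at the Eisenstein `𝔪`, Pan II
Thm 1.1.2 at `p = 2`) and of `close-approximation-cc`; registered here so that the composition
concludes the crux BY NAME for every `ρ`.  Hypotheses = the crux's, verbatim, plus
`¬ OrdinaryUpToTwist ρ`; conclusion in the newform rendering.  On the free-product range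
`S ⊆ {2, ℓ, ∞}`, `ℓ ≡ ±3 (8)`, this stub IS the whole crux (triage F1).  WHY IT MIGHT FAIL:
everything in the crux's own why-might-fail (Paškūnas–Tung's printed question; occurrence at an
Eisenstein `𝔪` at `p = 2`; no `2`-adic infinite fern through Eisenstein points in print).
Sources: PaskunasTung2021 §1.2 p.6, Thm 7.1; Pan2022LocallyAnalyticII Thm 1.1.2; Pan2022;
the cards `Ideas/koch-pro2-fern.md`, `Ideas/close-approximation-cc.md`. -/
def NonOrdinaryHalf : Prop :=
    ∀ (ρ : FramedGaloisRep ℚ (PadicAlgCl 2) 2), ¬ ρ.IsResiduallyAbsIrreducible →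
      ρ.toGaloisRep.IsIrreducible → ρ.IsOdd →
      (∀ᶠ v : HeightOneSpectrum (𝓞 ℚ) in cofinite, ρ.IsUnramifiedAt v) →
      (∀ (v : HeightOneSpectrum (𝓞 ℚ)) (hv : ((2 : ℕ) : 𝓞 ℚ) ∈ v.asIdeal),
        (Literature.NumberTheory.PAdicHodge.fontainePstAdicCompletion v 2 hv).IsDeRhamFramed
            (ρ.toLocal v) ∧
          ∀ τ : v.adicCompletion ℚ →+* PadicAlgCl 2, Continuous τ →
            (ρ.labelledHodgeTateWeightsAt v
              (Literature.NumberTheory.PAdicHodge.fontainePstAdicCompletion v 2 hv).algebra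
              (Literature.NumberTheory.PAdicHodge.fontainePstAdicCompletion v 2 hv).𝔅 τ).Nodup) →
      ¬ OrdinaryUpToTwist ρ → TateTwistNewform ρ

/-- **Registered stub S4 (REGIME STUB — the non-ordinary half, not this line's mechanism; open):
`NonOrdinaryHalf`** — see the docstring of the `def`. -/
theorem stub_nonOrdinaryHalf : NonOrdinaryHalf := by
  sorry

/-! ## 2. The composition: the four stubs close the crux BY NAME -/

/-- **Well-oriented Thorne points are newform points** (modus ponens on the named fact, pointwise;
the orientation is forgotten by `isOrdinaryOfWeightAt_of_isOriented`). [folklore] -/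
theorem isNewformPoint_of_isWellOrientedThornePoint
    (hT : Thorne2026_fontaineMazurGL2_potCrystallineOrdinary)
    (𝓕 : OrdDetFamily) (x : 𝓕.R →+* PadicAlgCl 2) (hx : 𝓕.IsWellOrientedThornePoint x) :
    𝓕.IsNewformPoint x := by
  obtain ⟨ρx, hD, hunr, hirr, hodd, χ₀, a, m, hχ₀, hm, hloc⟩ := hx
  refine ⟨ρx, hD, hT 2 ρx hunr hirr hodd ⟨χ₀, a, m, hχ₀, hm, fun v hv => ?_⟩⟩
  obtain ⟨hor, hdR, hN⟩ := hloc v hv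
  exact ⟨isOrdinaryOfWeightAt_of_isOriented hor, hdR, hN⟩

/-- **The composition, Galois side** (pure logic + the proved lemmas above): the four stub
statements give newform modularity up to a Tate twist for every `ρ` of the crux, by the case split
at `2`.  Stated with the stub propositions as NAMED hypotheses, so that the implication
`S1 → S2 → S3 → S4 → (crux, newform rendering)` is kernel-checked independently of the `sorry`s.
[folklore] -/
theorem tateTwistNewform_of_hypotheses (h₁ : OrdinaryFamilyDenseCapture)
    (h₂ : Thorne2026_fontaineMazurGL2_potCrystallineOrdinary) (h₃ : FamilyClassicality)
    (h₄ : NonOrdinaryHalf) (ρ : FramedGaloisRep ℚ (PadicAlgCl 2) 2)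
    (hres : ¬ ρ.IsResiduallyAbsIrreducible) (hirr : ρ.toGaloisRep.IsIrreducible) (hodd : ρ.IsOdd)
    (hunr : ∀ᶠ v : HeightOneSpectrum (𝓞 ℚ) in cofinite, ρ.IsUnramifiedAt v)
    (hdR : ∀ (v : HeightOneSpectrum (𝓞 ℚ)) (hv : ((2 : ℕ) : 𝓞 ℚ) ∈ v.asIdeal),
        (Literature.NumberTheory.PAdicHodge.fontainePstAdicCompletion v 2 hv).IsDeRhamFramed
            (ρ.toLocal v) ∧
          ∀ τ : v.adicCompletion ℚ →+* PadicAlgCl 2, Continuous τ →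
            (ρ.labelledHodgeTateWeightsAt v
              (Literature.NumberTheory.PAdicHodge.fontainePstAdicCompletion v 2 hv).algebra
              (Literature.NumberTheory.PAdicHodge.fontainePstAdicCompletion v 2 hv).𝔅 τ).Nodup) :
    TateTwistNewform ρ := by
  by_cases hord : OrdinaryUpToTwist ρ
  · obtain ⟨χ₀, a, k, m, hdat⟩ := hord
    obtain ⟨𝓕, x, hx, hD, hdense⟩ := h₁ ρ hres hirr hodd hunr hdR χ₀ a k m hdat
    have hdense' : 𝓕.Dense (fun y => (𝓕.IsWellOrientedThornePoint y ∧ 𝓕.IsNewformPoint y) ∨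
        𝓕.IsReduciblePoint y) :=
      𝓕.dense_mono (fun y _ hy => hy.imp
        (fun h => ⟨h, isNewformPoint_of_isWellOrientedThornePoint h₂ 𝓕 y h⟩) id) hdense
    exact h₃ 𝓕 hdense' x hx ρ χ₀ a k m hD hirr hdat
  · exact h₄ ρ hres hirr hodd hunr hdR hord

/-- **The composition: the crux BY NAME from the four registered stubs** (`stub_*` used by name;
Galois side `tateTwistNewform_of_hypotheses`, then the LANDED dictionary
`Theorems.exists_cuspidal_satakeFrobCompatible_of_tateTwistNewform` at the prime `2`). [folklore] -/
theorem DyadicEisensteinFM_of : DyadicEisensteinFM := by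
  intro ℓ _ hℓ ρ hres hirr hodd hunr hdR hcpt ι
  subst hℓ
  obtain ⟨χ, m, hχ, N, _, k, f, ιf, hf, hρ'⟩ :=
    tateTwistNewform_of_hypotheses stub_ordinaryFamilyDenseCapture stub_thorne2026
      stub_familyClassicality stub_nonOrdinaryHalf ρ hres hirr hodd hunr hdR
  exact Summit.Langlands.Langlands.Theorems.exists_cuspidal_satakeFrobCompatible_of_tateTwistNewform
    ρ hχ hf hρ' hcpt ι

end Summit.Langlands.Langlands.Cruxes.DyadicEisensteinFM.ThorneDenseWeightTwo

end
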